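import Literature.AnabelianGeometry.EtaleTheta.SettingModelChiDoubleUnderline
import Literature.AnabelianGeometry.EtaleTheta.SettingModelChiThetaCusp
import Literature.AnabelianGeometry.EtaleTheta.SingleUnderline
import HarnessLib

/-!
# [EtTh] §2 at the χ-model: the normaliser of `Π^tp_X̲̲ = Huuχ p l` in `Π^tp_X` lies in `Π^tp_X̲` (proof-only)

Mochizuki, *The Étale Theta Function …* [EtTh], Publ. RIMS 45 (2009), §2, Def 2.1 p.36 (`Π_{X̲}`, "`Gal(X̲/X) ≅ Q`"),
Def 2.3 p.38 / Def 2.5 (i) p.39 (`X̲̲ → X̲`, the choice `X̲̲`), Prop 2.2 (ii) p.37 ("the unique coset … that normalizes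
`Δ̄_{X̲̲}`") (bib key `MochizukiEtTh2009`).

PROOF-ONLY companion (no `def`, no instance, no new `Prop`; cell abc-iut, layer L2, seat abc-iut-w6-d049 gen 4; row «hNX at
the χ-model», the tempered input of abc-iut-L2-d3 g7's export lemma `temperedCoverDataOfHuuOfSection_mem_tp_PiCu …
(hNX : C.Huu.normalizer ≤ M.GtpXu l)` — the last junction clause «`ε_± ∈ T.tp T.PiCu`» of the Cor 2.8 (iii) OUTER chain at
the χ′ site, cf. `Discharge/Sec2OuterPC5Reduction` p455742 / `Discharge/Sec1EtaChiEpsMuFixes` p460521).  At the χ-twisted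
model `Π^tp_X = Γ ⋊_χ G_{ℚ_p}` (abc-iut-L2-t1 / abc-iut-L2-d1): `Π^tp_X̲̲ = Huuχ p l = {γ : x_l(γ) = 0 ∧ z_l(γ) = 0} ⋊ G_{ℚ_p}`
on the level-`l` Heisenberg shadow `(x, y, z)` (`mem_Huuχ_iff`), and `Π^tp_X̲ = GtpXu l = toZ⁻¹(l·ℤ)` (`x_l = 0`):
* `levelHom_z_conj_gfpOf_one` — for `γ₀ ∈ Γ` the conjugate `γ₀·b·γ₀⁻¹` of the loop `b` has `z`-level `= x`-level of `γ₀`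
  (Heisenberg law `(x,y,z)(x',y',z') = (x+x', y+y', z+z'+x·y')`);
* **`dvd_toZ_of_mem_normalizer_Huuχ`** — if `t = (γ₀, σ₀)` normalises `Huuχ p l` then `l ∣ toZ t`: test `t·h·t⁻¹ ∈ Huuχ`
  on `h := inl(θ_{σ₀⁻¹} b) ∈ Huuχ` (levels `(0, χ, 0)`), whose conjugate has `Γ`-part `γ₀·b·γ₀⁻¹`;
* **`normalizer_Huuχ_le_GtpXu`** (`ThetaSetting.modelχ`) and **`normalizer_Huuχ_le_GtpXu_modelχ'`** (the cusped twin,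
  same `toZ`): `normalizer (Huuχ p l) ≤ GtpXu l` — «N_{Π^tp_X}(Π^tp_X̲̲) ≤ Π^tp_X̲».
(The reverse inclusion FAILS at this model — a central `c^{z₀}` does not normalise the Galois factor of `Huuχ` when
`χ ≢ 1 (mod l)` — and is not claimed.)  HONEST FRAMING: semi-synthetic model, consistency evidence for the typed interface
only; nothing of [EtTh] is asserted; no side is taken on [IUTchIII] Cor 3.12; typed ≠ proved.
-/

noncomputable section

namespace Literature.AnabelianGeometry.EtaleTheta.SettingModel

open Literature.AnabelianGeometry.SemiGraphs _root_.Function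

variable (p : ℕ) [Fact p.Prime]

/-- **Heisenberg levels of `γ₀·b·γ₀⁻¹`**: the `z`-coordinate is the `x`-coordinate of `γ₀` (and `x = 0`, `y = 1`).
[cite: MochizukiEtTh2009, §1 p.12] -/
theorem levelHom_z_conj_gfpOf_one (N : ℕ+) (γ₀ : Gfp) :
    (levelHom N (γ₀ * gfpOf (FreeGroup.of 1) * γ₀⁻¹)).z = (levelHom N γ₀).x ∧
      (levelHom N (γ₀ * gfpOf (FreeGroup.of 1) * γ₀⁻¹)).x = 0 := by
  rw [map_mul, map_mul, map_inv, levelHom_gfpOf, heisHom_of_one]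
  refine ⟨?_, ?_⟩
  · simp [Heis.map_apply]
    ring
  · simp [Heis.map_apply]

/-- `inl (θ_σ b) ∈ Π^tp_X̲̲ = Huuχ p l` for every `σ` (levels `(0, χ_l σ, 0)`). [cite: MochizukiEtTh2009, Def 2.5 (i) p.39] -/
theorem inl_actχ_gfpOf_one_mem_Huuχ (l : ℕ+) (σ : GQp p) :
    (SemidirectProduct.inl (actχ p σ (gfpOf (FreeGroup.of 1))) : PiTpχ p) ∈ Huuχ p l := by
  rw [mem_Huuχ_iff, SemidirectProduct.left_inl, (chiTwistData p).hlev, chiTwistData_δ, levelHom_gfpOf, heisHom_of_one]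
  simp [Heis.map_apply]

/-- **If `t = (γ₀, σ₀)` normalises `Π^tp_X̲̲ = Huuχ p l` then `l ∣ toZ t`**: the conjugate of `h := inl(θ_{σ₀⁻¹} b) ∈ Huuχ`
by `t` has `Γ`-part `γ₀·b·γ₀⁻¹`, whose `z`-level is the `x`-level of `γ₀`, forced to vanish mod `l`.
[cite: MochizukiEtTh2009, Prop 2.2 (ii) p.37] -/
theorem dvd_toZ_of_mem_normalizer_Huuχ (l : ℕ+) {t : PiTpχ p} (ht : t ∈ Subgroup.normalizer (Huuχ p l : Set (PiTpχ p))) :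
    ((l : ℕ) : ℤ) ∣ Multiplicative.toAdd (gfpSnd t.left) := by
  set b : Gfp := gfpOf (FreeGroup.of 1) with hb
  have hact : ∀ x : Gfp, actχ p t.right (actχ p t.right⁻¹ x) = x := fun x => by
    rw [← MulAut.mul_apply, ← map_mul, mul_inv_cancel, map_one, MulAut.one_apply]
  have hconj := (Subgroup.mem_normalizer_iff.1 ht _).1 (inl_actχ_gfpOf_one_mem_Huuχ p l t.right⁻¹)
  have hleft : (t * SemidirectProduct.inl (actχ p t.right⁻¹ b) * t⁻¹).left = t.left * b * t.left⁻¹ := by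
    rw [SemidirectProduct.mul_left, SemidirectProduct.mul_left, SemidirectProduct.inv_left, SemidirectProduct.left_inl,
      SemidirectProduct.mul_right, SemidirectProduct.right_inl, mul_one, hact, hact]
  rw [mem_Huuχ_iff, hleft, hb] at hconj
  have hz := hconj.2
  rwa [(levelHom_z_conj_gfpOf_one l t.left).1, levelHom_x_eq_cast, ZMod.intCast_zmod_eq_zero_iff_dvd] at hz

/-- **«N_{Π^tp_X}(Π^tp_X̲̲) ≤ Π^tp_X̲» at the χ-model**: the normaliser of `Huuχ p l` in `Π^tp_X = Γ ⋊_χ G_{ℚ_p}` lies in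
`GtpXu l = toZ⁻¹(l·ℤ)` — the tempered input `hNX` of abc-iut-L2-d3's junction export for the Cor 2.8 (iii) OUTER chain.
[cite: MochizukiEtTh2009, Prop 2.2 (ii) p.37] -/
theorem normalizer_Huuχ_le_GtpXu (l : ℕ+) :
    Subgroup.normalizer (Huuχ p l : Set (PiTpχ p)) ≤ (ThetaSetting.modelχ p).GtpXu l := by
  intro t ht
  obtain ⟨k, hk⟩ := dvd_toZ_of_mem_normalizer_Huuχ p l ht
  change (chiTwistData p).toZ t ∈ Subgroup.zpowers (Multiplicative.ofAdd ((l : ℕ) : ℤ))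
  rw [GfpTwistData.toZ_apply, Subgroup.mem_zpowers_iff]
  refine ⟨k, Multiplicative.toAdd.injective ?_⟩
  rw [toAdd_zpow, toAdd_ofAdd, hk, smul_eq_mul, mul_comm]

/-- The same at the cusped χ-model `modelχ′` (same `Π^tp_X`, same `toZ`; the site of abc-iut-L2-t10's `OrbitEmbedding`
instance over `MuTwoSetting.inversionModelχ′`). [cite: MochizukiEtTh2009, Prop 2.2 (ii) p.37] -/
theorem normalizer_Huuχ_le_GtpXu_modelχ' (l : ℕ+) :
    Subgroup.normalizer (Huuχ p l : Set (PiTpχ p)) ≤ (ThetaSetting.modelχ' p).GtpXu l :=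
  normalizer_Huuχ_le_GtpXu p l

end Literature.AnabelianGeometry.EtaleTheta.SettingModel

end
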